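import Summits.Ventures.PercRepro.S1SixCircuitChainBase

/-!
# PercRepro — THE SPREAD `s₆` CHAIN, MODULO ITS PER-POINT TABLE: `s₆ ≤ Σ_{j ≤ d} q j` AND `s₆ ≤ ⌊n·B/(n − 6)⌋` INSIDE THE SPREAD
CLASS (p1, gen 33)

`proofs/P1-S2-CORANK6.md` §4j (3). S1CoreCapSpreadChainFive transposed to the six-circuits on the lemmas of S1SixCircuitChainBase
(the split `ncard_sixCircuits_le_through_add_delete`, the averaging `exists_nonColoop_ncard_sixCircuitsThrough_le`,
`le_mul_div_of_sub_div_le_six`): **`ncard_sixCircuits_le_sum_of_perPoint_hereditary`** (the deletion recursion inside a deletion-closed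
class), **`ncard_sixCircuits_le_capSum_spread_of`** (`s₆ ≤ capSum q d` on a spread e-free core whenever every spread core of nullity `j` has
`≤ q j` six-circuits through each point — the per-point SPREAD table `Q₆*_spread(1 … 5) = 1, 6, 21, q₄, q₅` of §4j, a HYPOTHESIS here),
**`ncard_sixCircuits_sub_div_le_of_nonColoops_spread`** (`s₆ − ⌊6·s₆/m⌋ ≤ B`) and **`ncard_sixCircuits_le_mul_div_spread_of`**
(`s₆ ≤ ⌊n·B/(n − 6)⌋` on a coloop-free spread core of nullity `d + 1` on `n` points: at `(13, 6)` with `B = Σ_{j ≤ 5} q j` it reads `⌊19·B/13⌋`).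
Nothing here is a cap by itself.
Axioms: standard.
-/

open scoped Matroid

namespace PercRepro

namespace S1

open Set

open FourCap

variable {α : Type}

/-- **The deletion recursion for the six-circuits inside a deletion-closed class** `P` of e-free cores (p3's recursion, p2's split
`ncard_sixCircuits_le_through_add_delete`): if every e-free core of nullity `j` in the class has at most `q j` six-circuits through
each point, an e-free core of nullity `d` in the class has at most `Σ_{j ≤ d} q j`. -/
theorem ncard_sixCircuits_le_sum_of_perPoint_hereditary (P : Matroid α → Prop)
    (hP : ∀ (M : Matroid α) (x : α), P M → P (M ＼ {x})) (q : ℕ → ℕ)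
    (hq : ∀ (M' : Matroid α) [M'.Finite],
      (∀ e ∈ M'.E, ∃ A ⊆ M'.E \ {e}, e ∉ M'.closure A ∧ e ∉ M'.closure ((M'.E \ {e}) \ A)) → P M' →
      ∀ j : ℕ, M'.E.encard = M'.eRank + j → ∀ e ∈ M'.E,
      {C : Set α | M'.IsCircuit C ∧ C.ncard = 6 ∧ e ∈ C}.ncard ≤ q j)
    (M : Matroid α) [M.Finite]
    (hfree : ∀ e ∈ M.E, ∃ A ⊆ M.E \ {e}, e ∉ M.closure A ∧ e ∉ M.closure ((M.E \ {e}) \ A)) (hPM : P M)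
    {d : ℕ} (hd : M.E.encard = M.eRank + d) :
    {C : Set α | M.IsCircuit C ∧ C.ncard = 6}.ncard ≤ (Finset.range (d + 1)).sum q := by
  suffices H : ∀ n : ℕ, ∀ (M : Matroid α) [M.Finite], M.E.ncard = n →
      (∀ e ∈ M.E, ∃ A ⊆ M.E \ {e}, e ∉ M.closure A ∧ e ∉ M.closure ((M.E \ {e}) \ A)) → P M →
      ∀ d : ℕ, M.E.encard = M.eRank + d →
      {C : Set α | M.IsCircuit C ∧ C.ncard = 6}.ncard ≤ (Finset.range (d + 1)).sum q from
    H _ M rfl hfree hPM d hd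
  intro n
  induction n using Nat.strong_induction_on with
  | _ n ih =>
  intro M _ hn hfree hPM d hd
  classical
  set S := {C : Set α | M.IsCircuit C ∧ C.ncard = 6} with hS
  by_cases hSe : S = ∅
  · rw [hSe, ncard_empty]; exact Nat.zero_le _
  obtain ⟨C₀, hC₀⟩ := nonempty_iff_ne_empty.2 hSe
  obtain ⟨e, heC₀⟩ := hC₀.1.nonempty
  have heE : e ∈ M.E := hC₀.1.subset_ground heC₀
  have hne : ¬ M.IsColoop e := hC₀.1.not_isColoop_of_mem heC₀
  have hν : M✶.eRank = (d : ℕ∞) := by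
    have h := _root_.Matroid.eRank_add_eRank_dual M
    rw [hd] at h
    exact WithTop.add_left_cancel (PercRepro.Matroid.eRank_ne_top_of_finite M) h
  have hdel := PercRepro.Matroid.dual_eRank_delete_singleton_add_one heE hne
  rw [hν] at hdel
  have hfin' : (M ＼ {e})✶.eRank ≠ ⊤ := by
    intro h
    rw [h] at hdel
    exact absurd hdel (by simp)
  obtain ⟨d', hd'⟩ := ENat.ne_top_iff_exists.1 hfin'
  have hdd' : d = d' + 1 := by
    rw [← hd'] at hdel
    exact_mod_cast hdel.symm
  have hd'enc : (M ＼ {e}).E.encard = (M ＼ {e}).eRank + d' := by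
    have h := _root_.Matroid.eRank_add_eRank_dual (M ＼ {e})
    rw [← hd'] at h
    exact h.symm
  have hdelE : (M ＼ {e}).E.ncard < n := by
    rw [_root_.Matroid.delete_ground, ← hn, ← ncard_sdiff_singleton_add_one heE M.ground_finite]
    omega
  have hfree' := S1.hfree_delete M hfree e
  have hsplit := S1.ncard_sixCircuits_le_through_add_delete M e
  rw [← hS] at hsplit
  have h1 := hq M hfree hPM d hd e heE
  have h2 := ih _ hdelE (M ＼ {e}) rfl hfree' (hP M e hPM) d' hd'enc
  subst hdd'
  rw [Finset.sum_range_succ]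
  have h2' : {C : Set α | (M ＼ {e}).IsCircuit C ∧ C.ncard = 6}.ncard ≤ ∑ x ∈ Finset.range (d' + 1), q x := h2
  omega

/-- **The spread `s₆` chain modulo its per-point table**: if every SPREAD e-free core of nullity `j` has at most `q j` six-circuits
through each point (the hypothesis `hq`), every spread e-free core of nullity `d` has `s₆ ≤ capSum q d = Σ_{j ≤ d} q j`. -/
theorem ncard_sixCircuits_le_capSum_spread_of (M : Matroid α) [M.Finite]
    (hfree : ∀ e ∈ M.E, ∃ A ⊆ M.E \ {e}, e ∉ M.closure A ∧ e ∉ M.closure ((M.E \ {e}) \ A))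
    (hns : ¬ ∃ W ⊆ M.E, W.ncard ≤ 9 ∧ W.encard = M.eRk W + 4)
    {d : ℕ} (hd : M.E.encard = M.eRank + d) (q : ℕ → ℕ)
    (hq : ∀ (M' : Matroid α) [M'.Finite],
      (∀ e ∈ M'.E, ∃ A ⊆ M'.E \ {e}, e ∉ M'.closure A ∧ e ∉ M'.closure ((M'.E \ {e}) \ A)) →
      (¬ ∃ W ⊆ M'.E, W.ncard ≤ 9 ∧ W.encard = M'.eRk W + 4) →
      ∀ j : ℕ, M'.E.encard = M'.eRank + j → ∀ e ∈ M'.E,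
      {C : Set α | M'.IsCircuit C ∧ C.ncard = 6 ∧ e ∈ C}.ncard ≤ q j) :
    {C : Set α | M.IsCircuit C ∧ C.ncard = 6}.ncard ≤ capSum q d :=
  ncard_sixCircuits_le_sum_of_perPoint_hereditary
    (fun M' => ¬ ∃ W ⊆ M'.E, W.ncard ≤ 9 ∧ W.encard = M'.eRk W + 4)
    (fun M' x h => spread_delete M' h x) q hq M hfree hns hd

open Classical in
/-- **The averaging recursion for `s₆` with an explicit count of non-coloops, inside the spread class**: on a spread core of nullity
`d + 1` with at least `m ≥ 1` non-coloops, if every SPREAD core of nullity `d` has `s₆ ≤ B`, then `s₆ − ⌊6·s₆/m⌋ ≤ B`. -/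
theorem ncard_sixCircuits_sub_div_le_of_nonColoops_spread (M : Matroid α) [M.Finite]
    (hfree : ∀ e ∈ M.E, ∃ A ⊆ M.E \ {e}, e ∉ M.closure A ∧ e ∉ M.closure ((M.E \ {e}) \ A))
    (hns : ¬ ∃ W ⊆ M.E, W.ncard ≤ 9 ∧ W.encard = M.eRk W + 4)
    {d : ℕ} (hd : M.E.encard = M.eRank + (d + 1)) {m : ℕ} (hm0 : 0 < m)
    (hm : m ≤ (M.E \ M.coloops).ncard) {B : ℕ}
    (hB : ∀ (M' : Matroid α) [M'.Finite],
      (∀ e ∈ M'.E, ∃ A ⊆ M'.E \ {e}, e ∉ M'.closure A ∧ e ∉ M'.closure ((M'.E \ {e}) \ A)) →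
      (¬ ∃ W ⊆ M'.E, W.ncard ≤ 9 ∧ W.encard = M'.eRk W + 4) →
      M'.E.encard = M'.eRank + d → {C : Set α | M'.IsCircuit C ∧ C.ncard = 6}.ncard ≤ B) :
    {C : Set α | M.IsCircuit C ∧ C.ncard = 6}.ncard -
      6 * {C : Set α | M.IsCircuit C ∧ C.ncard = 6}.ncard / m ≤ B := by
  rcases Nat.eq_zero_or_pos {C : Set α | M.IsCircuit C ∧ C.ncard = 6}.ncard with h0 | hpos
  · rw [h0]; simp
  obtain ⟨x, hxE, hxc, hx⟩ := exists_nonColoop_ncard_sixCircuitsThrough_le M hpos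
  have hm' : m ≤ (M.ground_finite.toFinset.filter (fun x => ¬ M.IsColoop x)).card := by
    have : (M.ground_finite.toFinset.filter (fun x => ¬ M.IsColoop x) : Set α) = M.E \ M.coloops := by
      ext y; simp only [Finset.coe_filter, Set.Finite.mem_toFinset, mem_setOf_eq, mem_sdiff,
        Matroid.isColoop_iff_mem_coloops]
    rw [← ncard_coe_finset, this]
    exact hm
  have hx' : {C : Set α | M.IsCircuit C ∧ C.ncard = 6 ∧ x ∈ C}.ncard ≤
      6 * {C : Set α | M.IsCircuit C ∧ C.ncard = 6}.ncard / m :=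
    hx.trans (Nat.div_le_div_left hm' hm0)
  have hν : M✶.eRank = ((d + 1 : ℕ) : ℕ∞) := by
    have h := _root_.Matroid.eRank_add_eRank_dual M
    rw [hd] at h
    exact WithTop.add_left_cancel (PercRepro.Matroid.eRank_ne_top_of_finite M) h
  have hdel := PercRepro.Matroid.dual_eRank_delete_singleton_add_one hxE hxc
  rw [hν] at hdel
  have hfin' : (M ＼ {x})✶.eRank ≠ ⊤ := by
    intro h
    rw [h] at hdel
    have h2 : ((d + 1 : ℕ) : ℕ∞) = ⊤ := by rw [← hdel]; simp
    exact ENat.coe_ne_top _ h2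
  obtain ⟨d', hd'⟩ := ENat.ne_top_iff_exists.1 hfin'
  have hdd' : d = d' := by
    rw [← hd'] at hdel
    have : d' + 1 = d + 1 := by exact_mod_cast hdel
    omega
  subst hdd'
  have hd'enc : (M ＼ {x}).E.encard = (M ＼ {x}).eRank + d := by
    have h := _root_.Matroid.eRank_add_eRank_dual (M ＼ {x})
    rw [← hd'] at h
    exact h.symm
  have hB' := hB (M ＼ {x}) (hfree_delete M hfree x) (spread_delete M hns x) hd'enc
  have hsplit := ncard_sixCircuits_le_through_add_delete M x
  omega

/-- **The spread `s₆` cell cap**: on a coloop-free spread e-free core of nullity `d + 1` on `n > 5` points, if every spread core of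
nullity `d` has `s₆ ≤ B`, then `s₆ ≤ ⌊n·B/(n − 5)⌋`. -/
theorem ncard_sixCircuits_le_mul_div_spread_of (M : Matroid α) [M.Finite]
    (hfree : ∀ e ∈ M.E, ∃ A ⊆ M.E \ {e}, e ∉ M.closure A ∧ e ∉ M.closure ((M.E \ {e}) \ A))
    (hns : ¬ ∃ W ⊆ M.E, W.ncard ≤ 9 ∧ W.encard = M.eRk W + 4)
    {d : ℕ} (hd : M.E.encard = M.eRank + (d + 1)) {n : ℕ} (hn : M.E.ncard = n) (hn6 : 6 < n)
    (hK : ∀ e, ¬ M.IsColoop e) {B : ℕ}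
    (hB : ∀ (M' : Matroid α) [M'.Finite],
      (∀ e ∈ M'.E, ∃ A ⊆ M'.E \ {e}, e ∉ M'.closure A ∧ e ∉ M'.closure ((M'.E \ {e}) \ A)) →
      (¬ ∃ W ⊆ M'.E, W.ncard ≤ 9 ∧ W.encard = M'.eRk W + 4) →
      M'.E.encard = M'.eRank + d → {C : Set α | M'.IsCircuit C ∧ C.ncard = 6}.ncard ≤ B) :
    {C : Set α | M.IsCircuit C ∧ C.ncard = 6}.ncard ≤ n * B / (n - 6) := by
  have hcol : M.coloops = ∅ := S2.coloops_eq_empty_of_forall_not M hK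
  have hm : n ≤ (M.E \ M.coloops).ncard := by rw [hcol, Set.sdiff_empty, hn]
  have h := ncard_sixCircuits_sub_div_le_of_nonColoops_spread M hfree hns hd (by omega) hm hB
  exact le_mul_div_of_sub_div_le_six hn6 h

end S1

end PercRepro
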